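/-
Copyright (c) 2026 the pub-hodgecm-mathlib formalisation cell (harness21).  Prover seat hodgecm-mathlib-K2Liu-p10 (g3), Track B «K2-LIT»,
#184♮ = hLiu418 = `stmt-HodgeConjecture-24832`; LEAD F0P6-plan (g13) RULING «M-157j» (1): G5-a sub-organ (α) (the middle cell of the
constant term), file α2d-2 — THE `N_Δ(L⁺)`-ORBITS OF THE MIDDLE CELL FOR `n = 2` ARE `B(L)∖GL₂(L) ≅ ℙ¹(L)`.
THEOREMS ONLY (no `def`, no `instance`, no named-fact hypothesis, no `sorry`).
-/
import Summits.HodgeConjecture.HodgeConjecture.Theorems.K2LiuSiegelMiddleCellLeviCriterion       -- α2d-1: frame criterion, `GL₂` Borel ↔ `ℙ¹`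
import Summits.HodgeConjecture.HodgeConjecture.Theorems.K2LiuSiegelEisensteinCoeffRestOrbits      -- ★ orbit API (`mk_mul_right_iff`, REST, …)
import HarnessLib

/-!
# Crux `HLiu418`, ROAD Φ, (α) file α2d-2: THE MIDDLE CELL OF `P_Δ(L⁺)∖H(L⁺)` FOR `n = 2` — ITS RIGHT `N_Δ(L⁺)`-ORBITS ARE THE
# `O(g) = {[w₀ Λ(ĝ) ν]}`, `g ∈ B(L)∖GL₂(L) ≅ ℙ¹(L)`, WITH STABILISERS `Λ(ĝ)⁻¹ · Stab([w₀]) · Λ(ĝ)`, `Stab([w₀]) = {u ∈ N_Δ(L⁺) : (X_u)₁₁ = 0}`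

Cell `hodgecm-mathlib`, crux item hLiu418 = `stmt-HodgeConjecture-24832` (helper lane, count-neutral).  "REST" is the set of cosets of
`P_Δ(L⁺)∖H(L⁺)` off `{[1]}` and off the big cell `[w_Δ N_Δ(L⁺)]` (★ `K2LiuSiegelEisensteinCoeffCells` ∕ `…RestOrbits`, big-cell representatives
`wq ν` BY VALUE).  With α2b (`γ = p w₀ p'`), α2c (`p' = Λ ĝ ν`) and the frame criterion of α2d-1:
* `isUnit_det_toBlocks₂₂_of_isSiegelDelta`, **`mk_mem_rest`** (a rational `γ ∉ P_Δ` with singular corner gives a REST coset — members of the big cell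
  have corner `−2 d_p`, ★ Part A (A4)), **`mk_reflStd_levi_unip_mem_rest`** (`[w₀ Λĝ ν] ∈ REST`);
* **`mk_levi_mem_orbit_iff`**: `[w₀ Λ ĝ'] ∈ O(g) ⟺ (g' g⁻¹)₁₀ = 0` (`⟺ [g'₁] = [g₁]` in `ℙ¹(L)`, α2d-1 `mk_row_eq_iff`), `range_subset_orbit_of_mk_mem`;
* **`exists_levi_of_mem_rest`** (O1: every REST coset is `[w₀ Λ ĝ ν]`), **`rest_eq_iUnion_orbit`** and **`pairwise_disjoint_orbit`** over a row section
  `γ : ℙ(L²) → GL₂(L)` — REST `= ⨆_{p ∈ ℙ¹(L)} O(γ p)`, the index set of the inner `GL₂` Eisenstein series of the constant term;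
* **`stabilizer_levi_iff`** (O3: `Stab([w₀ Λ ĝ]) = Λĝ⁻¹ · Stab([w₀]) · Λĝ` as a membership law, α2c `conj_levi_mem_ratH_iff`) and
  **`stabilizer_reflStd_iff`** (`w₀ u w₀⁻¹ ∈ P_Δ ⟺ (X_u)₁₁ = 0` for `u ∈ N_Δ(𝔸)`: `Stab([w₀]) = N_χ(L⁺)`, the corner line `X₁₁` is its complement).
Consumer: α3 `K2LiuConstantTermMiddleCellGL2` (the middle cell of the constant term `= Σ_{p ∈ ℙ¹(L)} F(Λ(γ p)^ h)` via α2a + α1).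
Sources: [GelbartPiatetskishapiroRallis1987, Part A §§1–2]; [KudlaRallis1994, §§1–2]; [MoeglinWaldspurger1995, II.1.7].
HONEST LABEL.  Helper lemmas, count-neutral; `HC_CM` is proved only modulo the 7 printed citations (2 remaining named inputs:
hLiu418 = `stmt-HodgeConjecture-24832`, h413 = `stmt-HodgeConjecture-24833`) until rung 0 closes.
-/

set_option autoImplicit false
set_option linter.dupNamespace false -- the mandated namespace repeats `HodgeConjecture.HodgeConjecture`

noncomputable section

open scoped Matrix
open NumberField IsDedekindDomain Set Function
open Literature.NumberTheory.Automorphic Literature.NumberTheory.Automorphic.UnitaryGroup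
open Literature.NumberTheory.GelbartRogawski1991 Literature.NumberTheory.GelbartRogawski1991.GRConstruction
open Literature.NumberTheory.GelbartRogawski1991.AdaptedBlocks
open Literature.NumberTheory.K2Lit.SiegelDoubled
open UnitaryDualPair

namespace Summit.HodgeConjecture.HodgeConjecture.Cruxes.HLiu418.K2LiuConstantTermMiddleCellOrbits

open K2LiuSiegelDoubledBlkUnitary K2LiuSiegelDoubledRationalPoints K2LiuSiegelDoubledLeviMatrix K2LiuSiegelDoubledLeviAlgebra
  K2LiuSiegelDoubledRationalFrames K2LiuSiegelLeviConjUnipDeltaChar K2LiuSiegelRationalLeviDecomposition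
  K2LiuSiegelBruhatCells K2LiuSiegelBruhatMiddleCell K2LiuSiegelBruhatMiddleCellDelta K2LiuSiegelBruhatMiddleCellExhaustion
  K2LiuSiegelMiddleCellSortedPattern K2LiuSiegelEisensteinCoeffOrbitSum K2LiuSiegelEisensteinCoeffNondegenerate K2LiuSiegelMiddleCellLeviCriterion

/-! ## §4 Cosets and orbits of the middle cell in `P_Δ(L⁺)∖H(L⁺)` -/

section Orbits

variable {L : Type} [Field L] [NumberField L] [IsCMField L]
variable {N M : ℕ} {e : Fin N × Fin M ≃ Fin 2}
  {dV : Fin N → L} {hdV : ∀ i, IsCMField.complexConj L (dV i) = dV i}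
  {dW : Fin M → L} {hdW : ∀ i, IsCMField.complexConj L (dW i) = dW i}

variable (wq : unipDeltaRat L e dV hdV dW hdW → ratH L e dV hdV dW hdW)
  (hwq : ∀ ν, ((wq ν : ratH L e dV hdV dW hdW) : HA L e dV hdV dW hdW) =
    weylDelta L e dV hdV dW hdW * ((ν : unipDelta L e dV hdV dW hdW) : HA L e dV hdV dW hdW))

/-- the `d`-block of a Siegel frame is invertible (frames are invertible: `frame(p) · frame(p⁻¹) = 1`). [folklore] -/
theorem isUnit_det_toBlocks₂₂_of_isSiegelDelta {p : HA L e dV hdV dW hdW} (hp : IsSiegelDelta L e dV hdV dW hdW p) :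
    IsUnit (Matrix.fromBlocks (1 : Matrix (Fin 2) (Fin 2) (AdeleRing (𝓞 L) L)) 0 (-1) 1 * blk L e dV hdV dW hdW p * Matrix.fromBlocks 1 0 1 1).toBlocks₂₂.det := by
  have hpf := fromBlocks_eq_of_toBlocks₂₁_eq_zero ((isSiegelDelta_iff_conj L e dV hdV dW hdW p).1 hp)
  have hinv : Matrix.fromBlocks (1 : Matrix (Fin 2) (Fin 2) (AdeleRing (𝓞 L) L)) 0 (-1) 1 * blk L e dV hdV dW hdW p * Matrix.fromBlocks 1 0 1 1 *
      (Matrix.fromBlocks (1 : Matrix (Fin 2) (Fin 2) (AdeleRing (𝓞 L) L)) 0 (-1) 1 * blk L e dV hdV dW hdW p⁻¹ * Matrix.fromBlocks 1 0 1 1) = 1 := by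
    rw [← conj_blk_mul, mul_inv_cancel, conj_blk_one]
  have hu : IsUnit (Matrix.fromBlocks (1 : Matrix (Fin 2) (Fin 2) (AdeleRing (𝓞 L) L)) 0 (-1) 1 * blk L e dV hdV dW hdW p * Matrix.fromBlocks 1 0 1 1).det :=
    Matrix.isUnit_det_of_right_inverse hinv
  rw [hpf] at hu
  exact ((isUnit_det_siegel_iff _ _ _).1 hu).2

include hwq in
/-- **REST membership from the corner**: a rational `γ` off `P_Δ` whose corner `C(γ)` has non-unit determinant gives a coset in REST (off `{[1]}`,
and off the big cell `[w_Δ N_Δ(L⁺)]`, whose members have corner `−2 d_p` with unit determinant, ★ Part A (A4)).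
[cite: GelbartPiatetskishapiroRallis1987, Part A §1] [cite: KudlaRallis1994, §1] -/
theorem mk_mem_rest {γ : HA L e dV hdV dW hdW} (hγ : γ ∈ ratH L e dV hdV dW hdW) (h0 : ¬ IsSiegelDelta L e dV hdV dW hdW γ)
    (hn : ¬ IsUnit (Matrix.fromBlocks (1 : Matrix (Fin 2) (Fin 2) (AdeleRing (𝓞 L) L)) 0 (-1) 1 * blk L e dV hdV dW hdW γ * Matrix.fromBlocks 1 0 1 1).toBlocks₂₁.det) :
    (Quotient.mk (MulAction.orbitRel (siegelDeltaRat L e dV hdV dW hdW) (ratH L e dV hdV dW hdW)) ⟨γ, hγ⟩ : SiegelDeltaQuot L e dV hdV dW hdW) ∈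
      (({Quotient.mk (MulAction.orbitRel (siegelDeltaRat L e dV hdV dW hdW) (ratH L e dV hdV dW hdW)) 1} ∪
        Set.range (fun ν : unipDeltaRat L e dV hdV dW hdW =>
          (Quotient.mk (MulAction.orbitRel (siegelDeltaRat L e dV hdV dW hdW) (ratH L e dV hdV dW hdW)) (wq ν) : SiegelDeltaQuot L e dV hdV dW hdW)))ᶜ :
        Set (SiegelDeltaQuot L e dV hdV dW hdW)) := by
  haveI : Nontrivial (AdeleRing (𝓞 L) L) := inferInstanceAs (Nontrivial (InfiniteAdeleRing L × FiniteAdeleRing (𝓞 L) L))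
  rintro (h | ⟨ν, h⟩)
  · have h1 := (mk_eq_mk_iff_isSiegelDelta _ _).1 (h : _ = _)
    rw [OneMemClass.coe_one, one_mul] at h1
    exact h0 (by simpa using isSiegelDelta_inv L e dV hdV dW hdW h1)
  · have hp := (mk_eq_mk_iff_isSiegelDelta _ _).1 (h : _ = _)
    -- `γ = p · w_Δ · ν` with `p := γ (w_Δ ν)⁻¹ ∈ P_Δ`
    have hγe : γ = γ * ((wq ν : ratH L e dV hdV dW hdW) : HA L e dV hdV dW hdW)⁻¹ * weylDelta L e dV hdV dW hdW *
        ((ν : unipDelta L e dV hdV dW hdW) : HA L e dV hdV dW hdW) := by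
      rw [hwq, mul_assoc, mul_assoc, inv_mul_cancel, mul_one]
    have hp0 := (isSiegelDelta_iff_conj L e dV hdV dW hdW _).1 hp
    have hPf := fromBlocks_eq_of_toBlocks₂₁_eq_zero hp0
    obtain ⟨X, hX⟩ := (mem_unipDelta_iff L e dV hdV dW hdW _).1 (ν : unipDelta L e dV hdV dW hdW).2
    apply hn
    rw [hγe, conj_blk_mul, conj_blk_mul, hPf, conjE_blk_weylDelta, hX, toBlocks₂₁_siegel_mul_weyl_mul_unip]
    exact isUnit_det_neg_two_smul (isUnit_det_toBlocks₂₂_of_isSiegelDelta hp)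

variable {g₀ : UnitaryGroup.rationalPair (Fp L) L (IsCMField.complexConj L) N M (Matrix.diagonal dV) (Matrix.diagonal dW)}
  (hg₀ : ((g₀ : GL (Fin N × Fin M) L) : Matrix (Fin N × Fin M) (Fin N × Fin M) L) = Matrix.diagonal (fun k => 1 - 2 * (![0, 1] : Fin 2 → L) (e k)))
  (Λ : GL (Fin 2) (AdeleRing (𝓞 L) L) →* HA L e dV hdV dW hdW)
  (hΛ : ∀ g : GL (Fin 2) (AdeleRing (𝓞 L) L), blk L e dV hdV dW hdW (Λ g) =
    cayR (AdeleRing (𝓞 L) L) (Fin 2) * Matrix.fromBlocks (g : Matrix (Fin 2) (Fin 2) (AdeleRing (𝓞 L) L)) 0 0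
      (((gramR L e dV hdV dW hdW).map ((algebraMap L (AdeleRing (𝓞 L) L)).comp (algebraMap (Fp L) L)))⁻¹ *
        (((g⁻¹ : GL (Fin 2) (AdeleRing (𝓞 L) L)) : Matrix (Fin 2) (Fin 2) (AdeleRing (𝓞 L) L)).map
          (conjAdele (Fp L) L (IsCMField.complexConj L)))ᵀ *
        (gramR L e dV hdV dW hdW).map ((algebraMap L (AdeleRing (𝓞 L) L)).comp (algebraMap (Fp L) L))) *
      cayRinv (AdeleRing (𝓞 L) L) (Fin 2))

include hwq hg₀ hΛ in
/-- **the cosets `[w₀ Λ ĝ ν]`, `g ∈ GL₂(L)`, `ν ∈ N_Δ(L⁺)`, lie in REST** (`w₀ · (Λĝ ν) ∉ P_Δ` and its corner `−2·diag(0,1)·ĝ` is singular).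
[cite: GelbartPiatetskishapiroRallis1987, Part A §1] [cite: KudlaRallis1994, §§1–2] -/
theorem mk_reflStd_levi_unip_mem_rest (g : GL (Fin 2) L) (ν : unipDeltaRat L e dV hdV dW hdW)
    (hγ₀ : iotaGG L e dV hdV dW hdW (1, UnitaryGroup.rationalPairToAdelic (Fp L) L (IsCMField.complexConj L) N M (Matrix.diagonal dV) (Matrix.diagonal dW) g₀) *
      Λ (Matrix.GeneralLinearGroup.map (algebraMap L (AdeleRing (𝓞 L) L)) g) ∈ ratH L e dV hdV dW hdW) :
    (Quotient.mk (MulAction.orbitRel (siegelDeltaRat L e dV hdV dW hdW) (ratH L e dV hdV dW hdW))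
        ((⟨_, hγ₀⟩ : ratH L e dV hdV dW hdW) * ⟨((ν : unipDelta L e dV hdV dW hdW) : HA L e dV hdV dW hdW), coe_mem_ratH ν⟩) : SiegelDeltaQuot L e dV hdV dW hdW) ∈
      (({Quotient.mk (MulAction.orbitRel (siegelDeltaRat L e dV hdV dW hdW) (ratH L e dV hdV dW hdW)) 1} ∪
        Set.range (fun ν : unipDeltaRat L e dV hdV dW hdW =>
          (Quotient.mk (MulAction.orbitRel (siegelDeltaRat L e dV hdV dW hdW) (ratH L e dV hdV dW hdW)) (wq ν) : SiegelDeltaQuot L e dV hdV dW hdW)))ᶜ :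
        Set (SiegelDeltaQuot L e dV hdV dW hdW)) := by
  have hq : IsSiegelDelta L e dV hdV dW hdW (Λ (Matrix.GeneralLinearGroup.map (algebraMap L (AdeleRing (𝓞 L) L)) g) *
      ((ν : unipDelta L e dV hdV dW hdW) : HA L e dV hdV dW hdW)) :=
    isSiegelDelta_mul L e dV hdV dW hdW (isSiegelDelta_levi_apply L e dV hdV dW hdW Λ hΛ _)
      (isSiegelDelta_of_mem_unipDelta L e dV hdV dW hdW (ν : unipDelta L e dV hdV dW hdW).2)
  have hval : (((⟨_, hγ₀⟩ : ratH L e dV hdV dW hdW) * ⟨((ν : unipDelta L e dV hdV dW hdW) : HA L e dV hdV dW hdW), coe_mem_ratH ν⟩ : ratH L e dV hdV dW hdW) :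
      HA L e dV hdV dW hdW) = iotaGG L e dV hdV dW hdW (1, UnitaryGroup.rationalPairToAdelic (Fp L) L (IsCMField.complexConj L) N M (Matrix.diagonal dV) (Matrix.diagonal dW) g₀) *
        (Λ (Matrix.GeneralLinearGroup.map (algebraMap L (AdeleRing (𝓞 L) L)) g) * ((ν : unipDelta L e dV hdV dW hdW) : HA L e dV hdV dW hdW)) := by
    rw [Subgroup.coe_mul, mul_assoc]
  haveI : Nontrivial (AdeleRing (𝓞 L) L) := inferInstanceAs (Nontrivial (InfiniteAdeleRing L × FiniteAdeleRing (𝓞 L) L))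
  have hmem : iotaGG L e dV hdV dW hdW (1, UnitaryGroup.rationalPairToAdelic (Fp L) L (IsCMField.complexConj L) N M (Matrix.diagonal dV) (Matrix.diagonal dW) g₀) *
      (Λ (Matrix.GeneralLinearGroup.map (algebraMap L (AdeleRing (𝓞 L) L)) g) * ((ν : unipDelta L e dV hdV dW hdW) : HA L e dV hdV dW hdW)) ∈
      ratH L e dV hdV dW hdW := by
    rw [← hval]; exact SetLike.coe_mem _
  have hnu : ¬ IsUnit ((Matrix.fromBlocks (1 : Matrix (Fin 2) (Fin 2) (AdeleRing (𝓞 L) L)) 0 (-1) 1 *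
      blk L e dV hdV dW hdW (iotaGG L e dV hdV dW hdW
        (1, UnitaryGroup.rationalPairToAdelic (Fp L) L (IsCMField.complexConj L) N M (Matrix.diagonal dV) (Matrix.diagonal dW) g₀) *
        (Λ (Matrix.GeneralLinearGroup.map (algebraMap L (AdeleRing (𝓞 L) L)) g) * ((ν : unipDelta L e dV hdV dW hdW) : HA L e dV hdV dW hdW))) *
      Matrix.fromBlocks 1 0 1 1).toBlocks₂₁).det := by
    rw [det_corner_reflStd_mul_siegel L e dV hdV dW hdW hg₀ hq]; exact not_isUnit_zero
  have h := mk_mem_rest wq hwq hmem (not_isSiegelDelta_reflStd_mul_siegel L e dV hdV dW hdW hg₀ hq) hnu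
  have heq : (⟨_, hmem⟩ : ratH L e dV hdV dW hdW) =
      (⟨_, hγ₀⟩ : ratH L e dV hdV dW hdW) * ⟨((ν : unipDelta L e dV hdV dW hdW) : HA L e dV hdV dW hdW), coe_mem_ratH ν⟩ := Subtype.ext hval.symm
  rwa [heq] at h

include hg₀ hΛ in
/-- **ORBIT MEMBERSHIP**: `[w₀ Λ ĝ'] ∈ O([w₀ Λ ĝ]) = {[w₀ Λ ĝ ν] : ν ∈ N_Δ(L⁺)} ⟺ (g' g⁻¹)₁₀ = 0` — (⇒) `[w₀Λĝν] = [w₀Λĝ']` means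
`w₀ · Λ(ĝ'ĝ⁻¹) · (Λĝ ν⁻¹ Λĝ⁻¹) · w₀ ∈ P_Δ`, and the frame criterion reads off `(g'g⁻¹)₁₀ = 0`; (⇐) `ν = 1`.
[cite: MoeglinWaldspurger1995, II.1.7] [cite: KudlaRallis1994, §2] -/
theorem mk_levi_mem_orbit_iff (g g' : GL (Fin 2) L)
    (hγ₀ : iotaGG L e dV hdV dW hdW (1, UnitaryGroup.rationalPairToAdelic (Fp L) L (IsCMField.complexConj L) N M (Matrix.diagonal dV) (Matrix.diagonal dW) g₀) *
      Λ (Matrix.GeneralLinearGroup.map (algebraMap L (AdeleRing (𝓞 L) L)) g) ∈ ratH L e dV hdV dW hdW)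
    (hγ₀' : iotaGG L e dV hdV dW hdW (1, UnitaryGroup.rationalPairToAdelic (Fp L) L (IsCMField.complexConj L) N M (Matrix.diagonal dV) (Matrix.diagonal dW) g₀) *
      Λ (Matrix.GeneralLinearGroup.map (algebraMap L (AdeleRing (𝓞 L) L)) g') ∈ ratH L e dV hdV dW hdW) :
    (Quotient.mk (MulAction.orbitRel (siegelDeltaRat L e dV hdV dW hdW) (ratH L e dV hdV dW hdW)) (⟨_, hγ₀'⟩ : ratH L e dV hdV dW hdW) :
        SiegelDeltaQuot L e dV hdV dW hdW) ∈
      Set.range (fun ν : unipDeltaRat L e dV hdV dW hdW =>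
        (Quotient.mk (MulAction.orbitRel (siegelDeltaRat L e dV hdV dW hdW) (ratH L e dV hdV dW hdW))
          ((⟨_, hγ₀⟩ : ratH L e dV hdV dW hdW) * ⟨((ν : unipDelta L e dV hdV dW hdW) : HA L e dV hdV dW hdW), coe_mem_ratH ν⟩) : SiegelDeltaQuot L e dV hdV dW hdW)) ↔
      ((g' * g⁻¹ : GL (Fin 2) L) : Matrix (Fin 2) (Fin 2) L) 1 0 = 0 := by
  have hw := reflStd_inv L e dV hdV dW hdW hg₀
  have hmap : Λ (Matrix.GeneralLinearGroup.map (algebraMap L (AdeleRing (𝓞 L) L)) g') *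
      (Λ (Matrix.GeneralLinearGroup.map (algebraMap L (AdeleRing (𝓞 L) L)) g))⁻¹ =
      Λ (Matrix.GeneralLinearGroup.map (algebraMap L (AdeleRing (𝓞 L) L)) (g' * g⁻¹)) := by
    rw [map_mul, map_mul, map_inv, map_inv]
  constructor
  · rintro ⟨ν, hν⟩
    have hP := (mk_eq_mk_iff_isSiegelDelta _ _).1 hν
    rw [Subgroup.coe_mul] at hP
    change IsSiegelDelta L e dV hdV dW hdW
      (iotaGG L e dV hdV dW hdW (1, UnitaryGroup.rationalPairToAdelic (Fp L) L (IsCMField.complexConj L) N M (Matrix.diagonal dV) (Matrix.diagonal dW) g₀) *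
        Λ (Matrix.GeneralLinearGroup.map (algebraMap L (AdeleRing (𝓞 L) L)) g') *
        (iotaGG L e dV hdV dW hdW (1, UnitaryGroup.rationalPairToAdelic (Fp L) L (IsCMField.complexConj L) N M (Matrix.diagonal dV) (Matrix.diagonal dW) g₀) *
          Λ (Matrix.GeneralLinearGroup.map (algebraMap L (AdeleRing (𝓞 L) L)) g) * ((ν : unipDelta L e dV hdV dW hdW) : HA L e dV hdV dW hdW))⁻¹) at hP
    -- rewrite as `w₀ · (Λ(ĝ'ĝ⁻¹) · ν₁) · w₀`, `ν₁ = Λĝ ν⁻¹ Λĝ⁻¹`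
    have hν₁ : Λ (Matrix.GeneralLinearGroup.map (algebraMap L (AdeleRing (𝓞 L) L)) g) * ((ν : unipDelta L e dV hdV dW hdW) : HA L e dV hdV dW hdW)⁻¹ *
        (Λ (Matrix.GeneralLinearGroup.map (algebraMap L (AdeleRing (𝓞 L) L)) g))⁻¹ ∈ unipDelta L e dV hdV dW hdW :=
      conj_levi_mem_unipDelta L e dV hdV dW hdW Λ hΛ _ (inv_mem (ν : unipDelta L e dV hdV dW hdW).2)
    have hrw : iotaGG L e dV hdV dW hdW (1, UnitaryGroup.rationalPairToAdelic (Fp L) L (IsCMField.complexConj L) N M (Matrix.diagonal dV) (Matrix.diagonal dW) g₀) *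
        Λ (Matrix.GeneralLinearGroup.map (algebraMap L (AdeleRing (𝓞 L) L)) g') *
        (iotaGG L e dV hdV dW hdW (1, UnitaryGroup.rationalPairToAdelic (Fp L) L (IsCMField.complexConj L) N M (Matrix.diagonal dV) (Matrix.diagonal dW) g₀) *
          Λ (Matrix.GeneralLinearGroup.map (algebraMap L (AdeleRing (𝓞 L) L)) g) * ((ν : unipDelta L e dV hdV dW hdW) : HA L e dV hdV dW hdW))⁻¹ =
      iotaGG L e dV hdV dW hdW (1, UnitaryGroup.rationalPairToAdelic (Fp L) L (IsCMField.complexConj L) N M (Matrix.diagonal dV) (Matrix.diagonal dW) g₀) *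
        (Λ (Matrix.GeneralLinearGroup.map (algebraMap L (AdeleRing (𝓞 L) L)) (g' * g⁻¹)) *
          (Λ (Matrix.GeneralLinearGroup.map (algebraMap L (AdeleRing (𝓞 L) L)) g) * ((ν : unipDelta L e dV hdV dW hdW) : HA L e dV hdV dW hdW)⁻¹ *
            (Λ (Matrix.GeneralLinearGroup.map (algebraMap L (AdeleRing (𝓞 L) L)) g))⁻¹)) *
        iotaGG L e dV hdV dW hdW (1, UnitaryGroup.rationalPairToAdelic (Fp L) L (IsCMField.complexConj L) N M (Matrix.diagonal dV) (Matrix.diagonal dW) g₀) := by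
      rw [← hmap]
      simp only [mul_inv_rev, hw, mul_assoc, inv_mul_cancel_left]
    rw [hrw, isSiegelDelta_reflStd_conj_levi_map_unip_iff L e dV hdV dW hdW hg₀ Λ hΛ _ hν₁] at hP
    exact hP.1
  · intro h
    refine ⟨1, (mk_eq_mk_iff_isSiegelDelta _ _).2 ?_⟩
    rw [Subgroup.coe_mul]
    change IsSiegelDelta L e dV hdV dW hdW
      (iotaGG L e dV hdV dW hdW (1, UnitaryGroup.rationalPairToAdelic (Fp L) L (IsCMField.complexConj L) N M (Matrix.diagonal dV) (Matrix.diagonal dW) g₀) *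
        Λ (Matrix.GeneralLinearGroup.map (algebraMap L (AdeleRing (𝓞 L) L)) g') *
        (iotaGG L e dV hdV dW hdW (1, UnitaryGroup.rationalPairToAdelic (Fp L) L (IsCMField.complexConj L) N M (Matrix.diagonal dV) (Matrix.diagonal dW) g₀) *
          Λ (Matrix.GeneralLinearGroup.map (algebraMap L (AdeleRing (𝓞 L) L)) g) *
            (((1 : unipDeltaRat L e dV hdV dW hdW) : unipDelta L e dV hdV dW hdW) : HA L e dV hdV dW hdW))⁻¹)
    rw [OneMemClass.coe_one, OneMemClass.coe_one, mul_one, mul_inv_rev, ← mul_assoc, mul_assoc _ (Λ _), hmap, hw]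
    exact (isSiegelDelta_reflStd_conj_levi_map_iff L e dV hdV dW hdW hg₀ Λ hΛ (g' * g⁻¹)).2 h

/-- **orbit transitivity**: if `[a] ∈ O(γ₀) = {[γ₀ ν]}` then `{[a ν]} ⊆ O(γ₀)`. [cite: MoeglinWaldspurger1995, II.1.7] -/
theorem range_subset_orbit_of_mk_mem {γ₀ a : ratH L e dV hdV dW hdW}
    (ha : (Quotient.mk (MulAction.orbitRel (siegelDeltaRat L e dV hdV dW hdW) (ratH L e dV hdV dW hdW)) a : SiegelDeltaQuot L e dV hdV dW hdW) ∈
      Set.range (fun ν : unipDeltaRat L e dV hdV dW hdW =>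
        (Quotient.mk (MulAction.orbitRel (siegelDeltaRat L e dV hdV dW hdW) (ratH L e dV hdV dW hdW))
          (γ₀ * ⟨((ν : unipDelta L e dV hdV dW hdW) : HA L e dV hdV dW hdW), coe_mem_ratH ν⟩) : SiegelDeltaQuot L e dV hdV dW hdW))) :
    Set.range (fun ν : unipDeltaRat L e dV hdV dW hdW =>
        (Quotient.mk (MulAction.orbitRel (siegelDeltaRat L e dV hdV dW hdW) (ratH L e dV hdV dW hdW))
          (a * ⟨((ν : unipDelta L e dV hdV dW hdW) : HA L e dV hdV dW hdW), coe_mem_ratH ν⟩) : SiegelDeltaQuot L e dV hdV dW hdW)) ⊆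
      Set.range (fun ν : unipDeltaRat L e dV hdV dW hdW =>
        (Quotient.mk (MulAction.orbitRel (siegelDeltaRat L e dV hdV dW hdW) (ratH L e dV hdV dW hdW))
          (γ₀ * ⟨((ν : unipDelta L e dV hdV dW hdW) : HA L e dV hdV dW hdW), coe_mem_ratH ν⟩) : SiegelDeltaQuot L e dV hdV dW hdW)) := by
  obtain ⟨ν₁, hν₁⟩ := ha
  dsimp only at hν₁
  rintro x ⟨ν, rfl⟩
  refine ⟨ν₁ * ν, ?_⟩
  have hmul : (⟨(((ν₁ * ν : unipDeltaRat L e dV hdV dW hdW) : unipDelta L e dV hdV dW hdW) : HA L e dV hdV dW hdW), coe_mem_ratH (ν₁ * ν)⟩ : ratH L e dV hdV dW hdW) =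
      (⟨((ν₁ : unipDelta L e dV hdV dW hdW) : HA L e dV hdV dW hdW), coe_mem_ratH ν₁⟩ : ratH L e dV hdV dW hdW) *
        ⟨((ν : unipDelta L e dV hdV dW hdW) : HA L e dV hdV dW hdW), coe_mem_ratH ν⟩ := rfl
  show (Quotient.mk (MulAction.orbitRel (siegelDeltaRat L e dV hdV dW hdW) (ratH L e dV hdV dW hdW))
      (γ₀ * ⟨(((ν₁ * ν : unipDeltaRat L e dV hdV dW hdW) : unipDelta L e dV hdV dW hdW) : HA L e dV hdV dW hdW), coe_mem_ratH (ν₁ * ν)⟩) : SiegelDeltaQuot L e dV hdV dW hdW) =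
    Quotient.mk (MulAction.orbitRel (siegelDeltaRat L e dV hdV dW hdW) (ratH L e dV hdV dW hdW)) (a * ⟨((ν : unipDelta L e dV hdV dW hdW) : HA L e dV hdV dW hdW), coe_mem_ratH ν⟩)
  rw [hmul, ← mul_assoc, mk_mul_right_iff, hν₁]

include hwq hg₀ hΛ in
/-- **(O1) EXHAUSTION**: every REST coset is `[w₀ Λ ĝ ν]` for some `g ∈ GL₂(L)`, `ν ∈ N_Δ(L⁺)` — α2b `exists_siegel_mul_reflStd_mul_siegel` (`γ_q = p w₀ p'`)
and α2c `exists_levi_mul_unip_of_rat_siegel` (`p' = Λ ĝ ν`), `[p w₀ Λĝ ν] = [w₀ Λĝ ν]`.  In particular `q ∈ O([w₀ Λ ĝ])`.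
[cite: GelbartPiatetskishapiroRallis1987, Part A §§1–2] [cite: MoeglinWaldspurger1995, II.1.7] -/
theorem exists_levi_of_mem_rest (hdV0 : ∀ i, dV i ≠ 0) (hdW0 : ∀ i, dW i ≠ 0) {q : SiegelDeltaQuot L e dV hdV dW hdW}
    (hq : q ∈ (({Quotient.mk (MulAction.orbitRel (siegelDeltaRat L e dV hdV dW hdW) (ratH L e dV hdV dW hdW)) 1} ∪
      Set.range (fun ν : unipDeltaRat L e dV hdV dW hdW =>
        (Quotient.mk (MulAction.orbitRel (siegelDeltaRat L e dV hdV dW hdW) (ratH L e dV hdV dW hdW)) (wq ν) : SiegelDeltaQuot L e dV hdV dW hdW)))ᶜ :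
        Set (SiegelDeltaQuot L e dV hdV dW hdW))) :
    ∃ (g : GL (Fin 2) L) (ν : unipDeltaRat L e dV hdV dW hdW)
      (hγ₀ : iotaGG L e dV hdV dW hdW (1, UnitaryGroup.rationalPairToAdelic (Fp L) L (IsCMField.complexConj L) N M (Matrix.diagonal dV) (Matrix.diagonal dW) g₀) *
        Λ (Matrix.GeneralLinearGroup.map (algebraMap L (AdeleRing (𝓞 L) L)) g) ∈ ratH L e dV hdV dW hdW),
      q = Quotient.mk (MulAction.orbitRel (siegelDeltaRat L e dV hdV dW hdW) (ratH L e dV hdV dW hdW))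
        ((⟨_, hγ₀⟩ : ratH L e dV hdV dW hdW) * ⟨((ν : unipDelta L e dV hdV dW hdW) : HA L e dV hdV dW hdW), coe_mem_ratH ν⟩) := by
  have hqR := hq
  simp only [Set.mem_compl_iff, Set.mem_union, Set.mem_range, not_or, not_exists] at hqR
  -- the representative is off `P_Δ` and off the big cell
  have h0 : ¬ IsSiegelDelta L e dV hdV dW hdW ((Quotient.out q : ratH L e dV hdV dW hdW) : HA L e dV hdV dW hdW) := by
    intro hS
    refine hqR.1 (((Quotient.out_eq q).symm.trans ((mk_eq_mk_iff_isSiegelDelta _ _).2 ?_)))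
    rw [OneMemClass.coe_one, one_mul]
    exact isSiegelDelta_inv L e dV hdV dW hdW hS
  have hnbig : ¬ IsUnit (Matrix.fromBlocks (1 : Matrix (Fin 2) (Fin 2) (AdeleRing (𝓞 L) L)) 0 (-1) 1 *
      blk L e dV hdV dW hdW ((Quotient.out q : ratH L e dV hdV dW hdW) : HA L e dV hdV dW hdW) * Matrix.fromBlocks 1 0 1 1).toBlocks₂₁.det := by
    intro hu
    obtain ⟨p, ν, hpr, hpP, hνN, hνr, hγe⟩ := exists_rat_siegel_weylDelta_unip L e dV hdV dW hdW hdV0 hdW0 (Quotient.out q : ratH L e dV hdV dW hdW).2 hu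
    refine hqR.2 ⟨⟨ν, hνN⟩, (mem_unipDeltaRat_iff L e dV hdV dW hdW _).2 hνr⟩ ?_
    refine ((mk_eq_mk_iff_isSiegelDelta _ _).2 ?_).trans (Quotient.out_eq q)
    rw [hγe, hwq]
    show IsSiegelDelta L e dV hdV dW hdW (p * weylDelta L e dV hdV dW hdW * ν * (weylDelta L e dV hdV dW hdW * ν)⁻¹)
    simp only [mul_inv_rev, mul_assoc, mul_inv_cancel_left, mul_inv_cancel, mul_one]
    exact hpP
  obtain ⟨p, p', hpr, hpP, hp'r, hp'P, hγe⟩ :=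
    exists_siegel_mul_reflStd_mul_siegel L e dV hdV dW hdW hdV0 hdW0 hg₀ (Quotient.out q : ratH L e dV hdV dW hdW).2 h0 hnbig
  obtain ⟨g, ν, hνN, hνr, hp'e⟩ := exists_levi_mul_unip_of_rat_siegel L e dV hdV dW hdW Λ hΛ hdV0 hdW0 hp'P hp'r
  have hγ₀ : iotaGG L e dV hdV dW hdW (1, UnitaryGroup.rationalPairToAdelic (Fp L) L (IsCMField.complexConj L) N M (Matrix.diagonal dV) (Matrix.diagonal dW) g₀) *
      Λ (Matrix.GeneralLinearGroup.map (algebraMap L (AdeleRing (𝓞 L) L)) g) ∈ ratH L e dV hdV dW hdW :=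
    mul_mem (iotaGG_one_mem_ratH L e dV hdV dW hdW g₀) (levi_map_mem_ratH L e dV hdV dW hdW Λ hΛ hdV0 hdW0 g)
  refine ⟨g, ⟨⟨ν, hνN⟩, (mem_unipDeltaRat_iff L e dV hdV dW hdW _).2 hνr⟩, hγ₀, ?_⟩
  refine (Quotient.out_eq q).symm.trans ((mk_eq_mk_iff_isSiegelDelta _ _).2 ?_)
  rw [Subgroup.coe_mul, hγe, hp'e]
  show IsSiegelDelta L e dV hdV dW hdW
    (iotaGG L e dV hdV dW hdW (1, UnitaryGroup.rationalPairToAdelic (Fp L) L (IsCMField.complexConj L) N M (Matrix.diagonal dV) (Matrix.diagonal dW) g₀) *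
        Λ (Matrix.GeneralLinearGroup.map (algebraMap L (AdeleRing (𝓞 L) L)) g) * ν *
      (p * iotaGG L e dV hdV dW hdW (1, UnitaryGroup.rationalPairToAdelic (Fp L) L (IsCMField.complexConj L) N M (Matrix.diagonal dV) (Matrix.diagonal dW) g₀) *
        (Λ (Matrix.GeneralLinearGroup.map (algebraMap L (AdeleRing (𝓞 L) L)) g) * ν))⁻¹)
  simp only [mul_inv_rev, mul_assoc, mul_inv_cancel_left]
  exact isSiegelDelta_inv L e dV hdV dW hdW hpP

include hwq hg₀ hΛ in
/-- **REST IS THE DISJOINT UNION OF THE ORBITS `O(γ p)`, `p ∈ ℙ¹(L)`**, for any row section `γ : ℙ(L²) → GL₂(L)` (`[(γ p)₁] = p`):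
`REST = ⋃_p {[w₀ Λ(γ p)^ ν] : ν ∈ N_Δ(L⁺)}`. [cite: KudlaRallis1994, §2] [cite: MoeglinWaldspurger1995, II.1.7] -/
theorem rest_eq_iUnion_orbit (hdV0 : ∀ i, dV i ≠ 0) (hdW0 : ∀ i, dW i ≠ 0) (γ : Projectivization L (Fin 2 → L) → GL (Fin 2) L)
    (hγ : ∀ p, Projectivization.mk L ((γ p : Matrix (Fin 2) (Fin 2) L) 1) (row_ne_zero (γ p) 1) = p)
    (hγ₀ : ∀ p, iotaGG L e dV hdV dW hdW (1, UnitaryGroup.rationalPairToAdelic (Fp L) L (IsCMField.complexConj L) N M (Matrix.diagonal dV) (Matrix.diagonal dW) g₀) *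
        Λ (Matrix.GeneralLinearGroup.map (algebraMap L (AdeleRing (𝓞 L) L)) (γ p)) ∈ ratH L e dV hdV dW hdW) :
    ((({Quotient.mk (MulAction.orbitRel (siegelDeltaRat L e dV hdV dW hdW) (ratH L e dV hdV dW hdW)) 1} ∪
      Set.range (fun ν : unipDeltaRat L e dV hdV dW hdW =>
        (Quotient.mk (MulAction.orbitRel (siegelDeltaRat L e dV hdV dW hdW) (ratH L e dV hdV dW hdW)) (wq ν) : SiegelDeltaQuot L e dV hdV dW hdW)))ᶜ :
        Set (SiegelDeltaQuot L e dV hdV dW hdW))) =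
      ⋃ p : Projectivization L (Fin 2 → L), Set.range (fun ν : unipDeltaRat L e dV hdV dW hdW =>
        (Quotient.mk (MulAction.orbitRel (siegelDeltaRat L e dV hdV dW hdW) (ratH L e dV hdV dW hdW))
          ((⟨_, hγ₀ p⟩ : ratH L e dV hdV dW hdW) * ⟨((ν : unipDelta L e dV hdV dW hdW) : HA L e dV hdV dW hdW), coe_mem_ratH ν⟩) : SiegelDeltaQuot L e dV hdV dW hdW)) := by
  refine Set.Subset.antisymm (fun q hq => ?_) (Set.iUnion_subset fun p => ?_)
  · obtain ⟨g, ν, hg, rfl⟩ := exists_levi_of_mem_rest wq hwq hg₀ Λ hΛ hdV0 hdW0 hq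
    set p := Projectivization.mk L ((g : Matrix (Fin 2) (Fin 2) L) 1) (row_ne_zero g 1) with hp
    refine Set.mem_iUnion.2 ⟨p, ?_⟩
    -- `[w₀ Λ ĝ] ∈ O(γ p)` since `[g₁] = p = [(γ p)₁]`
    have hmem := (mk_levi_mem_orbit_iff hg₀ Λ hΛ (γ p) g (hγ₀ p) hg).2 (((mk_row_eq_iff (γ p) g).1 (by rw [hγ p])))
    exact range_subset_orbit_of_mk_mem hmem ⟨ν, rfl⟩
  · rintro q ⟨ν, rfl⟩
    exact mk_reflStd_levi_unip_mem_rest wq hwq hg₀ Λ hΛ (γ p) ν (hγ₀ p)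

include hg₀ hΛ in
/-- **… AND THE ORBITS `O(γ p)` ARE PAIRWISE DISJOINT** (a common member `[w₀Λ(γp)^ν] = [w₀Λ(γp')^ν']` puts `[w₀ Λ(γ p')^]` in `O(γ p)`, so
`[(γ p')₁] = [(γ p)₁]`, `p' = p`). [cite: KudlaRallis1994, §2] [cite: MoeglinWaldspurger1995, II.1.7] -/
theorem pairwise_disjoint_orbit (γ : Projectivization L (Fin 2 → L) → GL (Fin 2) L)
    (hγ : ∀ p, Projectivization.mk L ((γ p : Matrix (Fin 2) (Fin 2) L) 1) (row_ne_zero (γ p) 1) = p)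
    (hγ₀ : ∀ p, iotaGG L e dV hdV dW hdW (1, UnitaryGroup.rationalPairToAdelic (Fp L) L (IsCMField.complexConj L) N M (Matrix.diagonal dV) (Matrix.diagonal dW) g₀) *
        Λ (Matrix.GeneralLinearGroup.map (algebraMap L (AdeleRing (𝓞 L) L)) (γ p)) ∈ ratH L e dV hdV dW hdW) :
    Pairwise (fun p p' => Disjoint
      (Set.range (fun ν : unipDeltaRat L e dV hdV dW hdW =>
        (Quotient.mk (MulAction.orbitRel (siegelDeltaRat L e dV hdV dW hdW) (ratH L e dV hdV dW hdW))
          ((⟨_, hγ₀ p⟩ : ratH L e dV hdV dW hdW) * ⟨((ν : unipDelta L e dV hdV dW hdW) : HA L e dV hdV dW hdW), coe_mem_ratH ν⟩) : SiegelDeltaQuot L e dV hdV dW hdW)))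
      (Set.range (fun ν : unipDeltaRat L e dV hdV dW hdW =>
        (Quotient.mk (MulAction.orbitRel (siegelDeltaRat L e dV hdV dW hdW) (ratH L e dV hdV dW hdW))
          ((⟨_, hγ₀ p'⟩ : ratH L e dV hdV dW hdW) * ⟨((ν : unipDelta L e dV hdV dW hdW) : HA L e dV hdV dW hdW), coe_mem_ratH ν⟩) : SiegelDeltaQuot L e dV hdV dW hdW)))) := by
  intro p p' hpp'
  refine Set.disjoint_left.2 fun x hx hx' => hpp' ?_
  obtain ⟨ν, rfl⟩ := hx
  obtain ⟨ν', hν'⟩ := hx'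
  dsimp only at hν'
  -- `[w₀ Λ(γ p')^] = [w₀ Λ(γ p)^ (ν ν'⁻¹)] ∈ O(γ p)`
  have hmem : (Quotient.mk (MulAction.orbitRel (siegelDeltaRat L e dV hdV dW hdW) (ratH L e dV hdV dW hdW)) (⟨_, hγ₀ p'⟩ : ratH L e dV hdV dW hdW) :
        SiegelDeltaQuot L e dV hdV dW hdW) ∈
      Set.range (fun ν : unipDeltaRat L e dV hdV dW hdW =>
        (Quotient.mk (MulAction.orbitRel (siegelDeltaRat L e dV hdV dW hdW) (ratH L e dV hdV dW hdW))
          ((⟨_, hγ₀ p⟩ : ratH L e dV hdV dW hdW) * ⟨((ν : unipDelta L e dV hdV dW hdW) : HA L e dV hdV dW hdW), coe_mem_ratH ν⟩) : SiegelDeltaQuot L e dV hdV dW hdW)) := by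
    refine ⟨ν * ν'⁻¹, ?_⟩
    have hmul : (⟨(((ν * ν'⁻¹ : unipDeltaRat L e dV hdV dW hdW) : unipDelta L e dV hdV dW hdW) : HA L e dV hdV dW hdW), coe_mem_ratH (ν * ν'⁻¹)⟩ : ratH L e dV hdV dW hdW) =
        (⟨((ν : unipDelta L e dV hdV dW hdW) : HA L e dV hdV dW hdW), coe_mem_ratH ν⟩ : ratH L e dV hdV dW hdW) *
          (⟨((ν' : unipDelta L e dV hdV dW hdW) : HA L e dV hdV dW hdW), coe_mem_ratH ν'⟩ : ratH L e dV hdV dW hdW)⁻¹ := rfl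
    show (Quotient.mk (MulAction.orbitRel (siegelDeltaRat L e dV hdV dW hdW) (ratH L e dV hdV dW hdW))
        ((⟨_, hγ₀ p⟩ : ratH L e dV hdV dW hdW) * ⟨(((ν * ν'⁻¹ : unipDeltaRat L e dV hdV dW hdW) : unipDelta L e dV hdV dW hdW) : HA L e dV hdV dW hdW), coe_mem_ratH (ν * ν'⁻¹)⟩) :
          SiegelDeltaQuot L e dV hdV dW hdW) = _
    rw [hmul, ← mul_assoc, ← mk_mul_right_iff _ _ (⟨((ν' : unipDelta L e dV hdV dW hdW) : HA L e dV hdV dW hdW), coe_mem_ratH ν'⟩ : ratH L e dV hdV dW hdW),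
      inv_mul_cancel_right, hν']
  have h10 := (mk_levi_mem_orbit_iff hg₀ Λ hΛ (γ p) (γ p') (hγ₀ p) (hγ₀ p')).1 hmem
  have hrow := (mk_row_eq_iff (γ p) (γ p')).2 h10
  rw [hγ, hγ] at hrow
  exact hrow.symm

include hΛ in
/-- **(O3) STABILISER TRANSPORT**: for `u ∈ N_Δ(𝔸)`, `u ∈ Stab([w₀ Λ ĝ])` (i.e. `u ∈ H(L⁺)` and `(w₀Λĝ) u (w₀Λĝ)⁻¹ ∈ P_Δ`) iff
`Λĝ u Λĝ⁻¹ ∈ Stab([w₀])` — `Stab([w₀ Λ ĝ]) = Λĝ⁻¹ · Stab([w₀]) · Λĝ` (α2c `conj_levi_mem_ratH_iff`). [cite: MoeglinWaldspurger1995, II.1.7] -/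
theorem stabilizer_levi_iff (hdV0 : ∀ i, dV i ≠ 0) (hdW0 : ∀ i, dW i ≠ 0) (g : GL (Fin 2) L) (u : HA L e dV hdV dW hdW) :
    (u ∈ ratH L e dV hdV dW hdW ∧ IsSiegelDelta L e dV hdV dW hdW
        (iotaGG L e dV hdV dW hdW (1, UnitaryGroup.rationalPairToAdelic (Fp L) L (IsCMField.complexConj L) N M (Matrix.diagonal dV) (Matrix.diagonal dW) g₀) *
          Λ (Matrix.GeneralLinearGroup.map (algebraMap L (AdeleRing (𝓞 L) L)) g) * u *
          (iotaGG L e dV hdV dW hdW (1, UnitaryGroup.rationalPairToAdelic (Fp L) L (IsCMField.complexConj L) N M (Matrix.diagonal dV) (Matrix.diagonal dW) g₀) *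
            Λ (Matrix.GeneralLinearGroup.map (algebraMap L (AdeleRing (𝓞 L) L)) g))⁻¹)) ↔
      (Λ (Matrix.GeneralLinearGroup.map (algebraMap L (AdeleRing (𝓞 L) L)) g) * u * (Λ (Matrix.GeneralLinearGroup.map (algebraMap L (AdeleRing (𝓞 L) L)) g))⁻¹ ∈
          ratH L e dV hdV dW hdW ∧
        IsSiegelDelta L e dV hdV dW hdW
          (iotaGG L e dV hdV dW hdW (1, UnitaryGroup.rationalPairToAdelic (Fp L) L (IsCMField.complexConj L) N M (Matrix.diagonal dV) (Matrix.diagonal dW) g₀) *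
            (Λ (Matrix.GeneralLinearGroup.map (algebraMap L (AdeleRing (𝓞 L) L)) g) * u * (Λ (Matrix.GeneralLinearGroup.map (algebraMap L (AdeleRing (𝓞 L) L)) g))⁻¹) *
            (iotaGG L e dV hdV dW hdW (1, UnitaryGroup.rationalPairToAdelic (Fp L) L (IsCMField.complexConj L) N M (Matrix.diagonal dV) (Matrix.diagonal dW) g₀))⁻¹)) := by
  rw [conj_levi_mem_ratH_iff L e dV hdV dW hdW Λ hΛ hdV0 hdW0]
  have hrw : iotaGG L e dV hdV dW hdW (1, UnitaryGroup.rationalPairToAdelic (Fp L) L (IsCMField.complexConj L) N M (Matrix.diagonal dV) (Matrix.diagonal dW) g₀) *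
          Λ (Matrix.GeneralLinearGroup.map (algebraMap L (AdeleRing (𝓞 L) L)) g) * u *
          (iotaGG L e dV hdV dW hdW (1, UnitaryGroup.rationalPairToAdelic (Fp L) L (IsCMField.complexConj L) N M (Matrix.diagonal dV) (Matrix.diagonal dW) g₀) *
            Λ (Matrix.GeneralLinearGroup.map (algebraMap L (AdeleRing (𝓞 L) L)) g))⁻¹ =
      iotaGG L e dV hdV dW hdW (1, UnitaryGroup.rationalPairToAdelic (Fp L) L (IsCMField.complexConj L) N M (Matrix.diagonal dV) (Matrix.diagonal dW) g₀) *
            (Λ (Matrix.GeneralLinearGroup.map (algebraMap L (AdeleRing (𝓞 L) L)) g) * u * (Λ (Matrix.GeneralLinearGroup.map (algebraMap L (AdeleRing (𝓞 L) L)) g))⁻¹) *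
            (iotaGG L e dV hdV dW hdW (1, UnitaryGroup.rationalPairToAdelic (Fp L) L (IsCMField.complexConj L) N M (Matrix.diagonal dV) (Matrix.diagonal dW) g₀))⁻¹ := by
    simp only [mul_inv_rev, mul_assoc]
  rw [hrw]

include hg₀ hΛ in
/-- **`Stab([w₀]) = {u ∈ N_Δ(L⁺) : (X_u)₁₁ = 0}`**: for `u ∈ N_Δ(𝔸)`, `w₀ u w₀⁻¹ ∈ P_Δ ⟺ (blk u)₁₂ ₁₁ = 0` (the frame criterion at `g = 1`) — the
subgroup `N_χ` of the HANDOFF (the corner line `S₁ ≅ 𝔸_{L⁺}` is its complement `X₁₁`). [cite: MoeglinWaldspurger1995, II.1.7] [cite: KudlaRallis1994, §2] -/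
theorem stabilizer_reflStd_iff {u : HA L e dV hdV dW hdW} (hu : u ∈ unipDelta L e dV hdV dW hdW) :
    IsSiegelDelta L e dV hdV dW hdW
        (iotaGG L e dV hdV dW hdW (1, UnitaryGroup.rationalPairToAdelic (Fp L) L (IsCMField.complexConj L) N M (Matrix.diagonal dV) (Matrix.diagonal dW) g₀) * u *
          (iotaGG L e dV hdV dW hdW (1, UnitaryGroup.rationalPairToAdelic (Fp L) L (IsCMField.complexConj L) N M (Matrix.diagonal dV) (Matrix.diagonal dW) g₀))⁻¹) ↔
      (blk L e dV hdV dW hdW u).toBlocks₁₂ 1 1 = 0 := by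
  have h := isSiegelDelta_reflStd_conj_levi_map_unip_iff L e dV hdV dW hdW hg₀ Λ hΛ 1 hu
  rw [map_one, map_one, one_mul, Units.val_one, Units.val_one, Matrix.one_mul, Matrix.one_apply_ne (by decide : (1 : Fin 2) ≠ 0)] at h
  rw [reflStd_inv L e dV hdV dW hdW hg₀, h]
  exact ⟨fun h' => h'.2, fun h' => ⟨rfl, h'⟩⟩

end Orbits

end Summit.HodgeConjecture.HodgeConjecture.Cruxes.HLiu418.K2LiuConstantTermMiddleCellOrbits

end
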